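import Summits.HubbardSuperconductivity.HubbardSuperconductivity.Theorems.AnisotropyChordAmplitudeStableHolds
import Summits.HubbardSuperconductivity.HubbardSuperconductivity.Theorems.AnisotropyChordEnergyConvexHolds
import Literature.Combinatorics.StablePolynomials.ElementarySymmetric

/-!
# Route `AnisotropyChord`: OCCUPATION-STABLE PAIRS — the initial pair `𝟙_W + u·𝟙_{W+1}` is stable
# (elementary symmetric polynomial of `Option V`), limits of stable pairs, and real combinations
# (helpers for THEOREM T-INT `XXZTowerProperPosition`; proved, no definition)

In the occupation convention of the BEC line (`1⁰_S` = value `0` on `S`, `1` off `S`; occupation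
polynomial `Σ_S φ(1⁰_S) z^S`, stability = no zero on `ℍ^V`):

* `occ_add_smul`, `occ_smul` — linearity in the coefficient vector;
* `occ_ind_eq_esymm` — the weight-`k` indicator `𝟙_k` has occupation polynomial `e_{n−k}(z)`;
* `occ_indPair_ne_zero` — **the initial pair of T-INT is stable**: `𝟙_W + u·𝟙_{W+1}` has occupation
  polynomial `e_{n−W}(z) + u e_{n−W−1}(z) = e_{n−W}(u ∷ z)`, the elementary symmetric polynomial of the
  `n+1` variables `(z,u)` of `Option V`, non-zero on `ℍ^{n+1}` by the tree's
  `Literature.Combinatorics.StablePolynomials.isUpperHalfPlaneStable_esymm` — so the spectator variable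
  of the theory seat's argument (memo ROTOR-THEORY-6 §65) is a genuine variable and no
  Hermite–Kakeya–Obreschkoff lemma is needed;
* `occStable_pair_of_limit` — if `A(t) + u·B(t)` is occupation-stable for all `u ∈ ℍ`, `t ≥ 0` and
  `A → a`, `B → b` with `a + u·b ≠ 0`, then `a + u·b` is occupation-stable («`0` or stable» is closed,
  `coneSel_isClosed_zero_or_stable` = multivariate Hurwitz);
* `zero_or_occStable_real_comb` — then every REAL combination `αa + βb` is `0` or occupation-stable
  (`u → β/α + i0⁺`, resp. `b = lim (−iε)(a + (i/ε)b)`): the orientation- and phase-free proper position.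

Theory seat `hubbard-h0-rotor-theory-1`, memo ROTOR-THEORY-6 §65; J. Borcea, P. Brändén, Invent. Math.
177 (2009) §2.2.  No definition is introduced.
-/

set_option linter.dupNamespace false

noncomputable section

namespace Summit.HubbardSuperconductivity.HubbardSuperconductivity.Theorems.AnisotropyChord

open Matrix Complex Finset Filter Topology
open scoped ComplexOrder
open Literature.MathematicalPhysics.QuantumLattice Literature.Probability.LatticeModels
open Summit.AtomisticToContinuum.BoseEinsteinCondensation.Cruxes.GroundStateStability.StableConeVariationalSelection
  (coneSel_isClosed_zero_or_stable coneSel_ne_zero_of_stable)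

variable {V : Type} [Fintype V] [DecidableEq V]

/-! ### Occupation polynomials: linearity, indicators, the initial pair -/

/-- The occupation polynomial `Σ_S φ(1⁰_S) z^S` is linear in the coefficient vector. [folklore] -/
theorem occ_add_smul (a b : ℂ) (φ ψ : TensorIndex V 2 → ℂ) (z : V → ℂ) :
    (∑ S : Finset V, (a • φ + b • ψ) (fun i => if i ∈ S then 0 else 1) * ∏ i ∈ S, z i) =
      a * (∑ S : Finset V, φ (fun i => if i ∈ S then 0 else 1) * ∏ i ∈ S, z i) +
        b * (∑ S : Finset V, ψ (fun i => if i ∈ S then 0 else 1) * ∏ i ∈ S, z i) := by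
  simp only [Pi.add_apply, Pi.smul_apply, smul_eq_mul, add_mul, Finset.sum_add_distrib,
    Finset.mul_sum, mul_assoc]

/-- Scalar case of `occ_add_smul`. [folklore] -/
theorem occ_smul (a : ℂ) (φ : TensorIndex V 2 → ℂ) (z : V → ℂ) :
    (∑ S : Finset V, (a • φ) (fun i => if i ∈ S then 0 else 1) * ∏ i ∈ S, z i) =
      a * (∑ S : Finset V, φ (fun i => if i ∈ S then 0 else 1) * ∏ i ∈ S, z i) := by
  simp only [Pi.smul_apply, smul_eq_mul, Finset.mul_sum, mul_assoc]

/-- **The occupation polynomial of the weight-`k` indicator is `e_{n−k}`** (`k ≤ n`): the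
configuration `1⁰_S` has weight `n − |S|`. [folklore] -/
theorem occ_ind_eq_esymm {k : ℕ} (hk : k ≤ Fintype.card V) (z : V → ℂ) :
    (∑ S : Finset V, (fun σ : V → Fin 2 =>
        if (Finset.univ.filter fun x => σ x = 1).card = k then (1 : ℂ) else 0)
        (fun i => if i ∈ S then 0 else 1) * ∏ i ∈ S, z i) =
      ((Finset.univ : Finset V).val.map z).esymm (Fintype.card V - k) := by
  rw [Finset.esymm_map_val, ← Finset.univ_filter_card_eq, Finset.sum_filter]
  refine Finset.sum_congr rfl fun S _ => ?_
  simp only [filter_indicator_eq_one_eq_compl, Finset.card_compl]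
  have hS : S.card ≤ Fintype.card V := S.card_le_univ
  by_cases h : S.card = Fintype.card V - k
  · rw [if_pos h, if_pos (by omega), one_mul]
  · rw [if_neg h, if_neg (by omega), zero_mul]

/-- `e_{k+1}(u ∷ s) = e_{k+1}(s) + u·e_k(s)`. [folklore] -/
theorem multiset_esymm_cons_succ (u : ℂ) (s : Multiset ℂ) (k : ℕ) :
    (u ::ₘ s).esymm (k + 1) = s.esymm (k + 1) + u * s.esymm k := by
  simp only [Multiset.esymm, Multiset.powersetCard_cons, Multiset.map_add, Multiset.sum_add,
    Multiset.map_map, Function.comp_def, Multiset.prod_cons]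
  rw [← Multiset.sum_map_mul_left]

omit [DecidableEq V] in
/-- The variables of `Option V` at the point `(u, z)` are `u ∷ (z_x)_x` as a multiset. [folklore] -/
theorem univ_option_val_map (u : ℂ) (z : V → ℂ) :
    ((Finset.univ : Finset (Option V)).val.map fun o : Option V => o.elim u z) =
      u ::ₘ (Finset.univ : Finset V).val.map z := by
  have h : (Finset.univ : Finset (Option V)).val = none ::ₘ ((Finset.univ : Finset V).val.map some) :=
    rfl
  rw [h, Multiset.map_cons, Multiset.map_map]
  rfl

/-- **The initial pair is stable:** for `W + 1 ≤ n`, `u ∈ ℍ` and `z ∈ ℍ^V`, the occupation polynomial of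
`𝟙_W + u·𝟙_{W+1}` is `e_{n−W}(z) + u e_{n−W−1}(z) = e_{n−W}(u ∷ z) ≠ 0` — the elementary symmetric
polynomial of `Option V` at the point `(u, z) ∈ ℍ^{Option V}` (tree: `isUpperHalfPlaneStable_esymm`).
[cite: BorceaBranden2009, Prop. 2.4] -/
theorem occ_indPair_ne_zero {W : ℕ} (hW : W + 1 ≤ Fintype.card V) {u : ℂ} (hu : 0 < u.im)
    {z : V → ℂ} (hz : ∀ i, 0 < (z i).im) :
    (∑ S : Finset V, ((fun σ : V → Fin 2 =>
        if (Finset.univ.filter fun x => σ x = 1).card = W then (1 : ℂ) else 0) +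
        u • (fun σ : V → Fin 2 =>
          if (Finset.univ.filter fun x => σ x = 1).card = W + 1 then (1 : ℂ) else 0))
        (fun i => if i ∈ S then 0 else 1) * ∏ i ∈ S, z i) ≠ 0 := by
  have hlin := occ_add_smul 1
    u (fun σ : V → Fin 2 => if (Finset.univ.filter fun x => σ x = 1).card = W then (1 : ℂ) else 0)
    (fun σ : V → Fin 2 => if (Finset.univ.filter fun x => σ x = 1).card = W + 1 then (1 : ℂ) else 0) z
  rw [one_smul] at hlin
  rw [hlin, one_mul, occ_ind_eq_esymm (by omega) z, occ_ind_eq_esymm hW z]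
  have hsucc : Fintype.card V - W = (Fintype.card V - (W + 1)) + 1 := by omega
  rw [hsucc, ← multiset_esymm_cons_succ, ← univ_option_val_map u z,
    ← MvPolynomial.aeval_esymm_eq_multiset_esymm (Option V) ℂ]
  have hst := Literature.Combinatorics.StablePolynomials.isUpperHalfPlaneStable_esymm (σ := Option V)
    (N := Fintype.card V - (W + 1) + 1) (by rw [Fintype.card_option]; omega)
  have hz' : ∀ o : Option V, 0 < ((fun o : Option V => o.elim u z) o).im := by
    intro o; cases o with
    | none => exact hu
    | some x => exact hz x
  exact hst (fun o : Option V => o.elim u z) hz'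

/-! ### Closedness arguments: limits of occupation-stable pairs, real combinations -/

/-- **Limits of stable pairs.**  If `A(t) + u·B(t)` has a stable occupation polynomial for every
`u ∈ ℍ` and `t ≥ 0`, `A → a`, `B → b`, and `a + u·b ≠ 0` for `u ∈ ℍ`, then `a + u·b` is
occupation-stable for every `u ∈ ℍ` («`0` or stable» is closed: `coneSel_isClosed_zero_or_stable`). [folklore] -/
theorem occStable_pair_of_limit {A B : ℝ → (TensorIndex V 2 → ℂ)} {a b : TensorIndex V 2 → ℂ}
    (hA : Tendsto A atTop (𝓝 a)) (hB : Tendsto B atTop (𝓝 b))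
    (hst : ∀ u : ℂ, 0 < u.im → ∀ t : ℝ, 0 ≤ t → ∀ z : V → ℂ, (∀ i, 0 < (z i).im) →
      (∑ S : Finset V, (A t + u • B t) (fun i => if i ∈ S then 0 else 1) * ∏ i ∈ S, z i) ≠ 0)
    (hne : ∀ u : ℂ, 0 < u.im → a + u • b ≠ 0) :
    ∀ u : ℂ, 0 < u.im → ∀ z : V → ℂ, (∀ i, 0 < (z i).im) →
      (∑ S : Finset V, (a + u • b) (fun i => if i ∈ S then 0 else 1) * ∏ i ∈ S, z i) ≠ 0 := by
  intro u hu
  have hlim : Tendsto (fun t => A t + u • B t) atTop (𝓝 (a + u • b)) := hA.add (hB.const_smul u)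
  have hmem := (coneSel_isClosed_zero_or_stable V).mem_of_tendsto hlim
    (by filter_upwards [eventually_ge_atTop (0 : ℝ)] with t ht using Or.inr (hst u hu t ht))
  rcases hmem with h0 | h
  · exact absurd h0 (hne u hu)
  · exact h

/-- **Real combinations of a stable pair are `0` or stable** (the orientation-free proper position):
if `a + u·b` is occupation-stable for every `u ∈ ℍ`, then for all real `α, β` the vector `α a + β b`
is `0` or occupation-stable (`u → β/α + i0⁺`, resp. `b = lim_{ε→0⁺} (−iε)(a + (i/ε) b)`; closedness).
[folklore] -/
theorem zero_or_occStable_real_comb {a b : TensorIndex V 2 → ℂ}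
    (h : ∀ u : ℂ, 0 < u.im → ∀ z : V → ℂ, (∀ i, 0 < (z i).im) →
      (∑ S : Finset V, (a + u • b) (fun i => if i ∈ S then 0 else 1) * ∏ i ∈ S, z i) ≠ 0)
    (α β : ℝ) :
    ((α : ℂ) • a + (β : ℂ) • b = 0) ∨ ∀ z : V → ℂ, (∀ i, 0 < (z i).im) →
      (∑ S : Finset V, ((α : ℂ) • a + (β : ℂ) • b) (fun i => if i ∈ S then 0 else 1) *
        ∏ i ∈ S, z i) ≠ 0 := by
  have hcl := coneSel_isClosed_zero_or_stable V
  -- scalar multiples of stable vectors are stable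
  have hsc : ∀ (c : ℂ), c ≠ 0 → ∀ φ : TensorIndex V 2 → ℂ,
      (∀ z : V → ℂ, (∀ i, 0 < (z i).im) →
        (∑ S : Finset V, φ (fun i => if i ∈ S then 0 else 1) * ∏ i ∈ S, z i) ≠ 0) →
      ∀ z : V → ℂ, (∀ i, 0 < (z i).im) →
        (∑ S : Finset V, (c • φ) (fun i => if i ∈ S then 0 else 1) * ∏ i ∈ S, z i) ≠ 0 := by
    intro c hc φ hφ z hz
    rw [occ_smul]
    exact mul_ne_zero hc (hφ z hz)
  by_cases hα : α = 0
  · subst hα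
    by_cases hβ : β = 0
    · left; subst hβ; simp
    · -- `b = lim_{ε → 0⁺} (−iε)•a + b`, each `(−iε)•(a + (i/ε)•b)` stable
      have hlim : Tendsto (fun ε : ℝ => (-((ε : ℂ) * I)) • a + b) (𝓝[>] 0) (𝓝 b) := by
        have hc : Continuous fun ε : ℝ => (-((ε : ℂ) * I)) • a + b := by fun_prop
        have := (hc.tendsto 0).mono_left (nhdsWithin_le_nhds (s := Set.Ioi (0 : ℝ)))
        simpa using this
      have hmem := hcl.mem_of_tendsto hlim (by
        refine eventually_nhdsWithin_of_forall fun ε (hε : 0 < ε) => Or.inr ?_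
        have hεne : (ε : ℂ) ≠ 0 := Complex.ofReal_ne_zero.mpr hε.ne'
        have hI : 0 < (I / (ε : ℂ)).im := by
          rw [div_eq_mul_inv, ← Complex.ofReal_inv, mul_comm, Complex.im_ofReal_mul, Complex.I_im,
            mul_one]
          exact inv_pos.mpr hε
        have heq : (-((ε : ℂ) * I)) • a + b = (-((ε : ℂ) * I)) • (a + (I / (ε : ℂ)) • b) := by
          rw [smul_add, smul_smul]
          have : (-((ε : ℂ) * I)) * (I / (ε : ℂ)) = 1 := by
            field_simp
            rw [Complex.I_sq]; ring
          rw [this, one_smul]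
        rw [heq]
        exact hsc _ (neg_ne_zero.mpr (mul_ne_zero hεne Complex.I_ne_zero)) _ (h _ hI))
      rcases hmem with hb0 | hb
      · left
        rw [hb0, smul_zero, Complex.ofReal_zero, zero_smul, add_zero]
      · right
        rw [Complex.ofReal_zero, zero_smul, zero_add]
        exact hsc _ (Complex.ofReal_ne_zero.mpr hβ) b hb
  · -- `α a + β b = α • (a + (β/α) • b) = lim_{ε→0⁺} α • (a + (β/α + iε) • b)`
    have hαne : (α : ℂ) ≠ 0 := Complex.ofReal_ne_zero.mpr hα
    have hlim : Tendsto (fun ε : ℝ => (α : ℂ) • (a + (((β / α : ℝ) : ℂ) + (ε : ℂ) * I) • b))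
        (𝓝[>] 0) (𝓝 ((α : ℂ) • a + (β : ℂ) • b)) := by
      have hc : Continuous fun ε : ℝ => (α : ℂ) • (a + (((β / α : ℝ) : ℂ) + (ε : ℂ) * I) • b) := by
        fun_prop
      have h0 := (hc.tendsto 0).mono_left (nhdsWithin_le_nhds (s := Set.Ioi (0 : ℝ)))
      have hval : (α : ℂ) • (a + (((β / α : ℝ) : ℂ) + ((0 : ℝ) : ℂ) * I) • b) =
          (α : ℂ) • a + (β : ℂ) • b := by
        rw [Complex.ofReal_zero, zero_mul, add_zero, smul_add, smul_smul, Complex.ofReal_div,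
          mul_div_cancel₀ _ hαne]
      rw [hval] at h0
      exact h0
    have hmem := hcl.mem_of_tendsto hlim (by
      refine eventually_nhdsWithin_of_forall fun ε (hε : 0 < ε) => Or.inr ?_
      have hI : 0 < ((((β / α : ℝ) : ℂ) + (ε : ℂ) * I)).im := by simpa using hε
      exact hsc _ hαne _ (h _ hI))
    exact hmem

end Summit.HubbardSuperconductivity.HubbardSuperconductivity.Theorems.AnisotropyChord
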